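import Summits.QuantumAdvantage.AdviceFreeQNC0.FibreDecimation37NHFibre
import Summits.QuantumAdvantage.AdviceFreeQNC0.FibreDecimation37LabelCount
import HarnessLib

/-!
# Cell qa-qnc0, `p = 3` — ROUND-37P2 §3.8 (ii), File E fibre by fibre: Lemma 37.D with a LABEL TERM and STEP 2 on a good fibre
# for a mixed population (generic tests + an arbitrary function of `R` label forms)

Planner qa-qnc0-p2 g37, ROUND-37P2 §3.8 (ii) (typed `Exp37.FibreNonExact37NHS`): the fibre parity is `f(u) + [h(⟨S_1,u⟩,…,⟨S_R,u⟩)]`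
with `h` ARBITRARY.  On the `y`-fibre the label term is `[h((⟨S_i|_M,w⟩ + σ_i(y))_i)]` (`hTerm`), `σ_i(y) = ⟨S_i|_Y,y⟩`; it passes through
the dual functional as ONE element `G(σ(y)) = L_a(hTerm_{σ(y)}·1_H) ∈ 𝔽₄` (`coefG`) depending on `y` only through `σ(y)`:

* `decimation_identity_label` — if `(g_{ρ,b} + X)·1_H ≡ 0` then `Σ_k ψ_k(ρ_k) + tr(θ·L_a(X·1_H)) = c₀` (Lemma 37.D with an extra term);
* `labelVal_glue`, `gfunX_eq_zero_of_agree`, `gfunX_mul_cosetInd_eq_zero_of_good` — agreement at a glued point kills `g + hTerm`;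
* **`good_fibre_parity_label`** — on a good even fibre `#{k : ⟨β_k|_Y,y⟩ ∈ Acc_k} + [gLab(σ(y))] ≡ c⋆ (mod 2)`, where
  `gLab(σ) = [tr(θ G(σ)) = 1]` is an arbitrary-looking but FIXED Boolean function of the outside label values;
* `nhs_weight_sum_le` — (NH/S) is the weight hypothesis of `card_parityClass_filter_label_le`.

WHAT THIS IS NOT: the assembly (`FibreDecimation37NHS.lean`) is the sequel; crux 22907 untouched; no separation.
-/

noncomputable section

namespace Summit.QuantumAdvantage.AdviceFreeQNC0.Exp37

open Finset
open Summit.QuantumAdvantage.AdviceFreeQNC0 F4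
open Literature.Computability.MetaComplexity Literature.Computability.MetaComplexity.ModTestProduct

variable {z s m R : ℕ}

/-! ### Lemma 37.D with an extra term -/

/-- **Decimation identity with an extra fibre term `X`**: if `(g_{ρ,b} + X)·1_{H_ε} ≡ 0` then
`Σ_k ψ_k(ρ_k) + tr(θ·L_a(X·1_H)) = tr(θ C)`. -/
theorem decimation_identity_label (a : Fin m → Bool) (ε : ℕ) (δ : Fin s → Fin m → ZMod 3) (T : Finset (Fin m))
    {θ : F4} (hθ : θ * coefU a ε = 1) (ρ : Fin s → ZMod 3) {b : F4} (hb : b = 0 ∨ b = 1)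
    (X : (Fin m → Bool) → F4) (hzero : ∀ w, (gfun δ T ρ b w + X w) * cosetInd ε w = 0) :
    (∑ k, psi θ (coefA a ε (δ k)) (coefA a ε (-δ k)) (ρ k)) + tr (θ * Lfun a (fun w => X w * cosetInd ε w)) =
      tr (θ * coefC a ε T) := by
  have hL : Lfun a (fun w => gfun δ T ρ b w * cosetInd ε w) + Lfun a (fun w => X w * cosetInd ε w) = 0 := by
    rw [← Lfun_add_fun]
    have e : (fun w => gfun δ T ρ b w * cosetInd ε w + X w * cosetInd ε w) = fun _ => (0 : F4) := by
      funext w; rw [← add_mul]; exact hzero w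
    rw [e]; exact Lfun_zero_fun a
  rw [Lfun_gfun_mul_cosetInd] at hL
  have htr : tr (θ * ((∑ k, (ω ^ (ρ k).val * coefA a ε (δ k) + ω ^ (2 * (ρ k).val) * coefA a ε (-δ k))) +
      coefC a ε T + b * coefU a ε + Lfun a (fun w => X w * cosetInd ε w))) = 0 := by
    rw [hL, mul_zero, tr_zero]
  rw [mul_add, mul_add, mul_add, tr_add, tr_add, tr_add, Finset.mul_sum, tr_sum] at htr
  have hbU : tr (θ * (b * coefU a ε)) = 0 := by
    rw [mul_left_comm, hθ, mul_one]
    rcases hb with rfl | rfl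
    · exact tr_zero
    · exact tr_one
  rw [hbU, add_zero] at htr
  unfold psi
  have h2 : (∑ k, tr (θ * (ω ^ (ρ k).val * coefA a ε (δ k) + ω ^ (2 * (ρ k).val) * coefA a ε (-δ k)))) +
      tr (θ * Lfun a (fun w => X w * cosetInd ε w)) + tr (θ * coefC a ε T) = 0 := by
    rw [← htr]; ring
  exact eq_of_add_eq_zero h2

/-! ### The label term on a fibre -/

/-- The label term on the fibre: `[h((⟨S_i|_M, w⟩ + σ_i)_i)] ∈ 𝔽₄`. -/
def hTerm (ι : Fin m ↪ Fin z) (Slab : Fin R → Fin z → ZMod 3) (h : (Fin R → ZMod 3) → Bool) (σ : Fin R → ZMod 3)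
    (w : Fin m → Bool) : F4 :=
  ιF (h (fun i => dotM (restrictM ι Slab i) w + σ i))

/-- `G(σ) = L_a(hTerm_σ · 1_{H_ε})`: the whole label contribution, as one element of `𝔽₄` per outside label value. -/
def coefG (a : Fin m → Bool) (ε : ℕ) (ι : Fin m ↪ Fin z) (Slab : Fin R → Fin z → ZMod 3) (h : (Fin R → ZMod 3) → Bool)
    (σ : Fin R → ZMod 3) : F4 :=
  Lfun a (fun w => hTerm ι Slab h σ w * cosetInd ε w)

open Classical in
/-- The decoded label bit `gLab(σ) = [tr(θ G(σ)) = 1]`. -/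
def gLab (a : Fin m → Bool) (ε : ℕ) (ι : Fin m ↪ Fin z) (Slab : Fin R → Fin z → ZMod 3) (h : (Fin R → ZMod 3) → Bool)
    (σ : Fin R → ZMod 3) : Bool :=
  decide (tr (theta a ε * coefG a ε ι Slab h σ) = 1)

/-- The label values at a glued point split: `⟨S_i, u⟩ = ⟨S_i|_M, w⟩ + ⟨S_i|_Y, y⟩`. -/
theorem labelVal_glue (ι : Fin m ↪ Fin z) (Slab : Fin R → Fin z → ZMod 3) (w : Fin m → Bool) (y : Out ι → Bool) :
    labelVal Slab (glue ι w y) = fun i => dotM (restrictM ι Slab i) w + subsetSum (dirOut ι Slab i) y := by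
  funext i
  exact form_glue ι Slab i w y

/-- **Agreement of the mixed parity ⇒ `g + hTerm` vanishes** at the glued point. -/
theorem gfunX_eq_zero_of_agree (ι : Fin m ↪ Fin z) (β : Fin s → Fin z → ZMod 3) (r : Fin s → ZMod 3) (μ₀ : ℕ)
    (T : Finset (Fin z)) (Slab : Fin R → Fin z → ZMod 3) (h : (Fin R → ZMod 3) → Bool) (w : Fin m → Bool)
    (y : Out ι → Bool)
    (hagree : (testParity β r (glue ι w y) + (if h (labelVal Slab (glue ι w y)) then 1 else 0)) % 2 =
      affTarget μ₀ T (glue ι w y) % 2) :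
    gfun (restrictM ι β) (tgtM ι T) (fun k => rho ι β r k y) (bOut ι μ₀ T y) w +
      hTerm ι Slab h (fun i => subsetSum (dirOut ι Slab i) y) w = 0 := by
  unfold testParity at hagree
  rw [card_test_glue, affTarget_glue, labelVal_glue] at hagree
  rw [gfun_glue_eq_natCast]
  unfold hTerm ιF
  by_cases hh : h (fun i => dotM (restrictM ι Slab i) w + subsetSum (dirOut ι Slab i) y) = true
  · rw [if_pos hh] at hagree ⊢
    rw [← Nat.cast_succ, natCast_eq, if_neg]
    omega
  · rw [if_neg hh] at hagree ⊢
    rw [add_zero, natCast_eq, if_neg]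
    omega

/-- **A good even fibre has `(g + hTerm)·1_{H_ε(M)} ≡ 0`.** -/
theorem gfunX_mul_cosetInd_eq_zero_of_good (ι : Fin m ↪ Fin z) (β : Fin s → Fin z → ZMod 3) (r : Fin s → ZMod 3)
    (μ₀ ε : ℕ) (T : Finset (Fin z)) (Slab : Fin R → Fin z → ZMod 3) (h : (Fin R → ZMod 3) → Bool)
    (y : Out ι → Bool) (hy : (univ.filter fun c => y c = true).card % 2 = 0)
    (hgood : ∀ u ∈ coset z ε, (fun c : Out ι => u c.1) = y →
      (testParity β r u + (if h (labelVal Slab u) then 1 else 0)) % 2 = affTarget μ₀ T u % 2) (w : Fin m → Bool) :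
    (gfun (restrictM ι β) (tgtM ι T) (fun k => rho ι β r k y) (bOut ι μ₀ T y) w +
      hTerm ι Slab h (fun i => subsetSum (dirOut ι Slab i) y) w) * cosetInd ε w = 0 := by
  unfold cosetInd
  split_ifs with hw
  · rw [mul_one]
    refine gfunX_eq_zero_of_agree ι β r μ₀ T Slab h w y (hgood _ ?_ (out_glue ι w y))
    unfold coset
    rw [mem_filter, card_true_glue]
    exact ⟨mem_univ _, by omega⟩
  · rw [mul_zero]

/-- **STEP 2 on a good even fibre, mixed population**: `#{k : ⟨β_k|_Y, y⟩ ∈ Acc_k} + [gLab(σ(y))] ≡ c⋆ (mod 2)`. -/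
theorem good_fibre_parity_label (ι : Fin m ↪ Fin z) (β : Fin s → Fin z → ZMod 3) (r : Fin s → ZMod 3)
    (a : Fin m → Bool) (μ₀ ε : ℕ) (T : Finset (Fin z)) (Slab : Fin R → Fin z → ZMod 3) (h : (Fin R → ZMod 3) → Bool)
    (hm : Odd m) (y : Out ι → Bool) (hy : (univ.filter fun c => y c = true).card % 2 = 0)
    (hgood : ∀ u ∈ coset z ε, (fun c : Out ι => u c.1) = y →
      (testParity β r u + (if h (labelVal Slab u) then 1 else 0)) % 2 = affTarget μ₀ T u % 2) :
    ((univ.filter fun k => subsetSum (dirOut ι β k) y ∈ accSet ι β r a ε k).card +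
      (if gLab a ε ι Slab h (fun i => subsetSum (dirOut ι Slab i) y) then 1 else 0)) % 2 = cStar ι a ε T % 2 := by
  classical
  have hb : bOut ι μ₀ T y = 0 ∨ bOut ι μ₀ T y = 1 := by
    unfold bOut; split_ifs
    · exact Or.inr rfl
    · exact Or.inl rfl
  have hid := decimation_identity_label a ε (restrictM ι β) (tgtM ι T) (theta_mul_coefU a ε hm)
    (fun k => rho ι β r k y) hb (hTerm ι Slab h (fun i => subsetSum (dirOut ι Slab i) y))
    (gfunX_mul_cosetInd_eq_zero_of_good ι β r μ₀ ε T Slab h y hy hgood)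
  -- the test sum is the cast of the count
  have hcount : (∑ k, psi (theta a ε) (coefA a ε (restrictM ι β k)) (coefA a ε (-restrictM ι β k)) (rho ι β r k y)) =
      ((univ.filter fun k => subsetSum (dirOut ι β k) y ∈ accSet ι β r a ε k).card : F4) := by
    rw [Finset.sum_congr rfl fun k _ => psi_eq_ite _ _ _ _, Finset.sum_boole]
    congr 2
    refine filter_congr fun k _ => ?_
    unfold accSet rho
    rw [mem_filter]
    simp
  -- the label term is the cast of the decoded bit
  have hlab : tr (theta a ε * Lfun a (fun w => hTerm ι Slab h (fun i => subsetSum (dirOut ι Slab i) y) w * cosetInd ε w)) =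
      ((if gLab a ε ι Slab h (fun i => subsetSum (dirOut ι Slab i) y) then 1 else 0 : ℕ) : F4) := by
    unfold gLab coefG
    rcases tr_cases (theta a ε * Lfun a (fun w => hTerm ι Slab h (fun i => subsetSum (dirOut ι Slab i) y) w * cosetInd ε w))
      with h0 | h1
    · rw [h0]
      have h01 : ¬ ((0 : F4) = 1) := fun h => one_ne_zero' h.symm
      simp [h01]
    · rw [h1]
      simp
  rw [hcount, hlab, ← Nat.cast_add, natCast_eq] at hid
  generalize ((univ.filter fun k => subsetSum (dirOut ι β k) y ∈ accSet ι β r a ε k).card +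
      (if gLab a ε ι Slab h (fun i => subsetSum (dirOut ι Slab i) y) then 1 else 0)) = M at hid ⊢
  unfold cStar
  rcases tr_cases (theta a ε * coefC a ε (tgtM ι T)) with h0 | h1
  · rw [h0] at hid ⊢
    rw [if_neg (fun h' => one_ne_zero' h'.symm)]
    by_contra hne
    rw [if_pos (by omega)] at hid
    exact one_ne_zero' hid
  · rw [h1] at hid ⊢
    rw [if_pos rfl]
    by_contra hne
    rw [if_neg (by omega)] at hid
    exact one_ne_zero' hid.symm

/-! ### (NH/S) as the weight hypothesis -/

/-- The weight of a combined outside form with labels is the typed `weightYDir`. -/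
theorem wt_combo_dirOut_add (ι : Fin m ↪ Fin z) (β : Fin s → Fin z → ZMod 3) (Slab : Fin R → Fin z → ZMod 3)
    (j : Fin s → ZMod 3) (γ : Fin R → ZMod 3) :
    ModTestProduct.wt (combo (dirOut ι β) j + combo (dirOut ι Slab) γ) =
      weightYDir ι (fun c => (∑ k, j k * β k c) + ∑ i, γ i * Slab i c) := by
  classical
  unfold ModTestProduct.wt weightYDir
  have e : (univ.filter fun c : Out ι => (combo (dirOut ι β) j + combo (dirOut ι Slab) γ) c ≠ 0) =
      univ.filter fun c : Out ι => ((∑ k, j k * β k c.1) + ∑ i, γ i * Slab i c.1) ≠ 0 := by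
    refine filter_congr fun c _ => ?_
    rw [Pi.add_apply]
    unfold combo dirOut
    exact Iff.rfl
  rw [e]
  exact card_filter_subtype ι (fun c => ((∑ k, j k * β k c) + ∑ i, γ i * Slab i c) ≠ 0)

/-- **(NH/S) is the weight hypothesis of STEP 3′ with labels** (for any presentation `P` of the index set). -/
theorem nhs_weight_sum_le (ι : Fin m ↪ Fin z) (a : Fin m → Bool) (β : Fin s → Fin z → ZMod 3)
    (Slab : Fin R → Fin z → ZMod 3) (hS : NHSCond ι a β Slab) (P : Finset ((Fin s → ZMod 3) × (Fin R → ZMod 3)))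
    (hP : ∀ jγ, jγ ∈ P ↔ (jγ ≠ 0 ∧ ∀ k, k ∉ decimSet ι a β → jγ.1 k = 0)) :
    ∑ jγ ∈ P, ((3 : ℝ) / 4) ^ ModTestProduct.wt (combo (dirOut ι β) jγ.1 + combo (dirOut ι Slab) jγ.2) ≤ 1 / 50 := by
  classical
  obtain ⟨-, h2⟩ := hS
  refine le_trans (le_of_eq ?_) h2
  refine Finset.sum_congr ?_ fun jγ _ => by rw [wt_combo_dirOut_add]
  ext jγ
  rw [hP jγ]
  simp only [mem_filter, mem_univ, true_and]

end Summit.QuantumAdvantage.AdviceFreeQNC0.Exp37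

end
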